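import Literature.RepresentationTheory.AlgebraicGroups.Sl2StringRep
import Literature.NumberTheory.Automorphic.NilpotentExpRootHom
import HarnessLib

/-!
# Exponentiating an integrable `sl₂`-triple of matrices to `SL₂(k) → GL n k`

Representation theory of `SL₂` (namespace `Literature.RepresentationTheory.AlgebraicGroups.Sl2Exp`),
the matrix form of `Sl2StringRep.lean`, needed for the clause `exists_sl2Hom` of
`IsRootDatumOf` in Chevalley's existence theorem (Springer, *Linear Algebraic Groups*, 2nd ed.,
7.3, 8.1.8, 10.1.1; `Literature.NumberTheory.Automorphic.chevalley_existence`). An **integrable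
triple** is `(H, E, F)` with `H = diag (h_c)` of integer diagonal entries, `[H, E] = 2E`,
`[H, F] = -2F`, `[E, F] = H ≠ 0`, `E`, `F` nilpotent (`IsIntegrableTriple`). Over an
algebraically closed field of characteristic `0` we prove (everything is proved):

* `expRep : SL₂(k) →* GL n k`, the representation integrating the triple (the action on the
  strings of `kⁿ`, `Sl2StringRep.rep`, transported to matrices);
* **`expRep (!![1, x; 0, 1]) = exp (x E)`**, **`expRep (!![1, 0; x, 1]) = exp (x F)`**
  (`coe_expRep_unipotentUpperSL2`, `coe_expRep_unipotentLowerSL2`) and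
  **`expRep (diag (a, a⁻¹)) = diag (a ^ {h_c})`** (`coe_expRep_diagSL2`: the string basis vectors
  are weight vectors of `H`, on whose support `h_c` is the weight);
* `expRep` takes values in any subgroup containing the `exp (x E)`, `exp (x F)` (`expRep_mem`,
  `SL₂(k)` being generated by unipotents, Mathlib `SL2.transvection_induction`), has
  determinant `1` (`det_coe_expRep`), and is **algebraic** (`isAlgebraicSL2Hom_codRestrict`:
  its entries are polynomials in the entries of `g`, by a constant change of basis from the
  polynomial entries `Sym^m (g)_{ij}`).

## Mathlib

`Matrix.SpecialLinearGroup.SL2.transvection_induction`, `LinearMap.toMatrixAlgEquiv'`,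
`LinearMap.toMatrix'_toLin'`, `basis_toMatrix_mul_linearMap_toMatrix_mul_basis_toMatrix`,
`LinearMap.toMatrix_toLin`, `Matrix.mvPolynomialX`. Nothing here duplicates a Mathlib
declaration.

## References

* T. A. Springer, *Linear Algebraic Groups*, 2nd ed. (1998), 7.3, 8.1.8, 10.1.1 [SpringerLAG1998].
* R. Steinberg, *Lectures on Chevalley groups*, Yale (1968), §3.
-/

noncomputable section

namespace Literature.RepresentationTheory.AlgebraicGroups.Sl2Exp

open Module LieModule
open Literature.Algebra.Lie.Sl2 Literature.RepresentationTheory.AlgebraicGroups.SL2Sym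
  Literature.RepresentationTheory.AlgebraicGroups.Sl2Rep
open Literature.NumberTheory.Automorphic (unipotentUpperSL2 unipotentLowerSL2 diagSL2
  coe_unipotentUpperSL2 coe_unipotentLowerSL2 coe_diagSL2 glCoordFun glCoordFun_inl
  glCoordFun_inr IsAlgebraicSL2Hom det_exp_smul)
open scoped MatrixGroups

attribute [local instance 100] LieRing.ofAssociativeRing

variable {k : Type*} [Field k]
variable {n : Type*} [Fintype n] [DecidableEq n]

/-- The diagonal matrix `H = diag (h_c)` of integer entries. [folklore] -/
def hDiag (hm : n → ℤ) : Matrix n n k := Matrix.diagonal fun c => (hm c : k)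

/-- **An integrable `sl₂`-triple of matrices**: `H = diag (h_c)` with integer entries, `E`, `F`
nilpotent, `[H, E] = 2E`, `[H, F] = -2F`, `[E, F] = H ≠ 0`. [folklore] -/
structure IsIntegrableTriple (hm : n → ℤ) (E F : Matrix n n k) : Prop where
  lie_h_e : hDiag hm * E - E * hDiag hm = (2 : k) • E
  lie_h_f : hDiag hm * F - F * hDiag hm = (-2 : k) • F
  lie_e_f : E * F - F * E = hDiag hm
  isNilpotent_e : IsNilpotent E
  isNilpotent_f : IsNilpotent F
  hDiag_ne_zero : hDiag (k := k) hm ≠ 0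

namespace IsIntegrableTriple

variable {hm : n → ℤ} {E F : Matrix n n k} (ht : IsIntegrableTriple hm E F)
include ht

/-- The triple of endomorphisms is an `sl₂`-triple in Mathlib's sense. [folklore] -/
lemma isSl2Triple : IsSl2Triple (Matrix.toLin' (hDiag (k := k) hm)) (Matrix.toLin' E)
    (Matrix.toLin' F) where
  h_ne_zero := fun h0 => ht.hDiag_ne_zero (Matrix.toLin'.injective (by rw [h0, map_zero]))
  lie_e_f := by
    rw [Ring.lie_def, ← ht.lie_e_f, map_sub, Matrix.toLin'_mul, Matrix.toLin'_mul]; rfl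
  lie_h_e_nsmul := by
    rw [Ring.lie_def, ← Nat.cast_smul_eq_nsmul k, Nat.cast_ofNat, ← map_smul, ← ht.lie_h_e,
      map_sub, Matrix.toLin'_mul, Matrix.toLin'_mul]; rfl
  lie_h_f_nsmul := by
    rw [Ring.lie_def, ← Nat.cast_smul_eq_nsmul k, Nat.cast_ofNat, ← neg_smul, ← map_smul,
      ← ht.lie_h_f, map_sub, Matrix.toLin'_mul, Matrix.toLin'_mul]; rfl

omit ht in
/-- The standard basis vectors are weight vectors of `diag (h_c)`, so `H` is diagonalisable.
[folklore] -/
lemma hdiag : ⨆ μ : k, wsp (Matrix.toLin' (hDiag (k := k) hm)) μ = ⊤ := by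
  rw [eq_top_iff, ← (Pi.basisFun k n).span_eq, Submodule.span_le]
  rintro _ ⟨c, rfl⟩
  refine Submodule.mem_iSup_of_mem (hm c : k) ?_
  rw [mem_wsp_iff, Matrix.toLin'_apply, Pi.basisFun_apply, hDiag, Matrix.mulVec_single_one]
  ext c'
  by_cases h : c' = c
  · subst h; simp
  · simp [h]

/-- The finite type of non-zero pieces (for the string basis). [folklore] -/
@[reducible] def fintypeNE [CharZero k] : Fintype (NE (Matrix.toLin' (hDiag (k := k) hm))
    (Matrix.toLin' E) (Matrix.toLin' F)) :=
  fintypeSimPieceNeBot ht.isSl2Triple hdiag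

variable [CharZero k] [IsAlgClosed k]

/-- **The representation `SL₂(k) → GL n k` integrating the triple** (Springer 7.3, 10.1.1;
Steinberg §3). [folklore] -/
def expRep : SL(2, k) →* GL n k :=
  letI := ht.fintypeNE
  letI := Classical.decEq k
  ((LinearMap.toMatrixAlgEquiv' : Module.End k (n → k) ≃ₐ[k] Matrix n n k).toAlgHom.toMonoidHom.comp
    (rep ht.isSl2Triple hdiag)).toHomUnits

/-- The matrix of `expRep g` is the standard matrix of `rep g`. [folklore] -/
lemma coe_expRep (g : SL(2, k)) : ((ht.expRep g : GL n k) : Matrix n n k) =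
    letI := ht.fintypeNE; letI := Classical.decEq k
    LinearMap.toMatrix' (rep ht.isSl2Triple hdiag g) := rfl

/-- **`expRep (!![1, x; 0, 1]) = exp (x E)`.** [folklore] -/
theorem coe_expRep_unipotentUpperSL2 (x : k) :
    ((ht.expRep (unipotentUpperSL2 (Multiplicative.ofAdd x)) : GL n k) : Matrix n n k) =
      IsNilpotent.exp (x • E) := by
  letI := ht.fintypeNE; letI := Classical.decEq k
  rw [coe_expRep, rep_unipotentUpperSL2 ht.isSl2Triple hdiag ht.isNilpotent_e,
    LinearMap.toMatrix'_toLin']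

/-- **`expRep (!![1, 0; x, 1]) = exp (x F)`.** [folklore] -/
theorem coe_expRep_unipotentLowerSL2 (x : k) :
    ((ht.expRep (unipotentLowerSL2 (Multiplicative.ofAdd x)) : GL n k) : Matrix n n k) =
      IsNilpotent.exp (x • F) := by
  letI := ht.fintypeNE; letI := Classical.decEq k
  rw [coe_expRep, rep_unipotentLowerSL2 ht.isSl2Triple hdiag ht.isNilpotent_f,
    LinearMap.toMatrix'_toLin']

/-- `expRep` on `exp (x E)` / `exp (x F)` as the one-parameter groups `expHom`. [folklore] -/
lemma expRep_unipotentUpperSL2 (x : Multiplicative k) :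
    ht.expRep (unipotentUpperSL2 x) =
      Literature.NumberTheory.Automorphic.expHom E ht.isNilpotent_e x := by
  apply Units.ext
  rw [← ofAdd_toAdd x, coe_expRep_unipotentUpperSL2]
  rfl

/-- `expRep` on `!![1, 0; x, 1]` is the one-parameter group `expHom F`. [folklore] -/
lemma expRep_unipotentLowerSL2 (x : Multiplicative k) :
    ht.expRep (unipotentLowerSL2 x) =
      Literature.NumberTheory.Automorphic.expHom F ht.isNilpotent_f x := by
  apply Units.ext
  rw [← ofAdd_toAdd x, coe_expRep_unipotentLowerSL2]
  rfl

omit ht [IsAlgClosed k] in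
/-- The weights of `diag (h_c)` on a weight vector: on the support of `v ∈ V_μ`, `h_c = μ`.
[folklore] -/
lemma hm_eq_of_mem_wsp {μ : ℤ} {v : n → k}
    (hv : v ∈ wsp (Matrix.toLin' (hDiag (k := k) hm)) (μ : k)) {c : n} (hc : v c ≠ 0) :
    hm c = μ := by
  rw [mem_wsp_iff, Matrix.toLin'_apply, hDiag] at hv
  have h := congrFun hv c
  rw [Matrix.mulVec_diagonal, Pi.smul_apply, smul_eq_mul] at h
  exact_mod_cast mul_right_cancel₀ hc h

/-- **`expRep (diag (a, a⁻¹)) = diag (a ^ {h_c})`**: the torus of `SL₂` acts through the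
weights of `H`. [folklore] -/
theorem coe_expRep_diagSL2 (a : kˣ) :
    ((ht.expRep (diagSL2 a) : GL n k) : Matrix n n k) =
      Matrix.diagonal fun c => ((a ^ hm c : kˣ) : k) := by
  letI := ht.fintypeNE; letI := Classical.decEq k
  rw [coe_expRep]
  apply Matrix.toLin'.injective
  rw [Matrix.toLin'_toMatrix']
  refine (stringBasis ht.isSl2Triple hdiag).ext fun τ => ?_
  rw [rep_diagSL2_stringBasis ht.isSl2Triple hdiag a τ, Matrix.toLin'_apply]
  -- the basis vector is a weight vector of weight `m - 2j`
  set m := mOf (strT τ)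
  set j := posT ht.isSl2Triple hdiag τ
  have hjm : j ≤ m := posT_le ht.isSl2Triple hdiag τ
  have hw := (headV_primitive ht.isSl2Triple hdiag (strT τ)).1
  have hv : stringBasis ht.isSl2Triple hdiag τ ∈
      wsp (Matrix.toLin' (hDiag (k := k) hm)) (((m : ℤ) - 2 * j : ℤ) : k) := by
    rw [stringBasis_eq]
    have h := apply_F_pow_mem ht.isSl2Triple hw j
    convert h using 2
    push_cast; ring
  funext c
  rw [Matrix.mulVec_diagonal, Pi.smul_apply, smul_eq_mul]
  by_cases hc : stringBasis ht.isSl2Triple hdiag τ c = 0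
  · rw [hc, mul_zero, mul_zero]
  · rw [hm_eq_of_mem_wsp hv hc]
    congr 1
    rw [← Units.val_pow_eq_pow_val, ← Units.val_pow_eq_pow_val, ← Units.val_mul,
      ← zpow_natCast, ← zpow_natCast, inv_zpow', ← zpow_add, Nat.cast_sub hjm]
    congr 2
    ring

/-- **`expRep` takes values in every subgroup containing the `exp (x E)` and `exp (x F)`**
(`SL₂(k)` is generated by its unipotent elements). [folklore] -/
theorem expRep_mem {G : Subgroup (GL n k)}
    (hU : ∀ x : Multiplicative k, ht.expRep (unipotentUpperSL2 x) ∈ G)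
    (hL : ∀ x : Multiplicative k, ht.expRep (unipotentLowerSL2 x) ∈ G) (g : SL(2, k)) :
    ht.expRep g ∈ G := by
  refine Matrix.SL2.transvection_induction (fun g => ht.expRep g ∈ G)
    (fun i j hij c => ?_) (fun A B hA hB => by rw [map_mul]; exact G.mul_mem hA hB) g
  fin_cases i <;> fin_cases j
  · exact absurd rfl hij
  · have h : Matrix.SpecialLinearGroup.transvection hij c =
        unipotentUpperSL2 (Multiplicative.ofAdd c) := by
      ext a b; fin_cases a <;> fin_cases b <;>
        simp [Matrix.SpecialLinearGroup.transvection, Matrix.transvection]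
    rw [h]; exact hU _
  · have h : Matrix.SpecialLinearGroup.transvection hij c =
        unipotentLowerSL2 (Multiplicative.ofAdd c) := by
      ext a b; fin_cases a <;> fin_cases b <;>
        simp [Matrix.SpecialLinearGroup.transvection, Matrix.transvection]
    rw [h]; exact hL _
  · exact absurd rfl hij

/-- **`det (expRep g) = 1`** (the unipotent generators have determinant `1`). [folklore] -/
theorem det_coe_expRep (g : SL(2, k)) : ((ht.expRep g : GL n k) : Matrix n n k).det = 1 := by
  let G : Subgroup (GL n k) := (Matrix.GeneralLinearGroup.det (n := n) (R := k)).ker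
  have hmem : ht.expRep g ∈ G := by
    refine ht.expRep_mem (fun x => ?_) (fun x => ?_) g
    · rw [MonoidHom.mem_ker, Units.ext_iff, Matrix.GeneralLinearGroup.val_det_apply,
        ← ofAdd_toAdd x, coe_expRep_unipotentUpperSL2, det_exp_smul ht.isNilpotent_e, Units.val_one]
    · rw [MonoidHom.mem_ker, Units.ext_iff, Matrix.GeneralLinearGroup.val_det_apply,
        ← ofAdd_toAdd x, coe_expRep_unipotentLowerSL2, det_exp_smul ht.isNilpotent_f, Units.val_one]
  rw [MonoidHom.mem_ker, Units.ext_iff, Matrix.GeneralLinearGroup.val_det_apply] at hmem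
  exact hmem

/-! ### Algebraicity -/

/-- The matrix of `expRep g` is a constant conjugate of the string-basis matrix `repMat g`.
[folklore] -/
lemma coe_expRep_eq_conj (g : SL(2, k)) :
    letI := ht.fintypeNE; letI := Classical.decEq k
    ((ht.expRep g : GL n k) : Matrix n n k) =
      (Pi.basisFun k n).toMatrix (stringBasis ht.isSl2Triple hdiag) *
        repMat ht.isSl2Triple hdiag (g : Matrix (Fin 2) (Fin 2) k) *
          (stringBasis ht.isSl2Triple hdiag).toMatrix (Pi.basisFun k n) := by
  letI := ht.fintypeNE; letI := Classical.decEq k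
  rw [coe_expRep, rep_apply, ← LinearMap.toMatrix_eq_toMatrix',
    ← basis_toMatrix_mul_linearMap_toMatrix_mul_basis_toMatrix (Pi.basisFun k n)
      (stringBasis ht.isSl2Triple hdiag) (Pi.basisFun k n) (stringBasis ht.isSl2Triple hdiag),
    LinearMap.toMatrix_toLin]

/-- The string-basis matrix with polynomial entries. [folklore] -/
def repMatPoly : letI := ht.fintypeNE
    Matrix (Idx (Matrix.toLin' (hDiag (k := k) hm)) (Matrix.toLin' E) (Matrix.toLin' F))
      (Idx (Matrix.toLin' (hDiag (k := k) hm)) (Matrix.toLin' E) (Matrix.toLin' F))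
      (MvPolynomial (Fin 2 × Fin 2) k) :=
  letI := Classical.decEq k
  fun τ τ' => if strT τ = strT τ' then
    MvPolynomial.C (qT ht.isSl2Triple hdiag τ * (qT ht.isSl2Triple hdiag τ')⁻¹) *
      symCoeff (mOf (strT τ)) (Matrix.mvPolynomialX (Fin 2) (Fin 2) k)
        (posT ht.isSl2Triple hdiag τ) (posT ht.isSl2Triple hdiag τ')
    else 0

omit [IsAlgClosed k] in
/-- Evaluating `repMatPoly` at `g` gives `repMat g`. [folklore] -/
lemma eval_repMatPoly (g : Matrix (Fin 2) (Fin 2) k) :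
    letI := ht.fintypeNE
    (ht.repMatPoly).map (MvPolynomial.eval fun ab : Fin 2 × Fin 2 => g ab.1 ab.2) =
      letI := Classical.decEq k; repMat ht.isSl2Triple hdiag g := by
  letI := ht.fintypeNE; letI := Classical.decEq k
  ext τ τ'
  rw [Matrix.map_apply, repMatPoly, repMat]
  split_ifs with h
  · rw [map_mul, MvPolynomial.eval_C, eval_symCoeff_mvPolynomialX]
  · rw [map_zero]

/-- **`expRep` is algebraic**: its entries are polynomials in the entries of `g` (and its
`det⁻¹`-coordinate is `1`). [folklore] -/
theorem isAlgebraicSL2Hom_codRestrict {G : Subgroup (GL n k)} (hG : ∀ g, ht.expRep g ∈ G) :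
    IsAlgebraicSL2Hom ((ht.expRep).codRestrict G hG) := by
  letI := ht.fintypeNE; letI := Classical.decEq k
  let C₁ : Matrix n _ (MvPolynomial (Fin 2 × Fin 2) k) :=
    ((Pi.basisFun k n).toMatrix (stringBasis ht.isSl2Triple hdiag)).map MvPolynomial.C
  let C₂ : Matrix _ n (MvPolynomial (Fin 2 × Fin 2) k) :=
    ((stringBasis ht.isSl2Triple hdiag).toMatrix (Pi.basisFun k n)).map MvPolynomial.C
  refine ⟨Sum.elim (fun ab => (C₁ * ht.repMatPoly * C₂) ab.1 ab.2) (fun _ => MvPolynomial.C 1),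
    fun g c => ?_⟩
  rcases c with ⟨a, b⟩ | ⟨⟩
  · simp only [MonoidHom.codRestrict_apply, glCoordFun_inl, Sum.elim_inl]
    have h1 : C₁.map (MvPolynomial.eval fun ab : Fin 2 × Fin 2 =>
        (g : Matrix (Fin 2) (Fin 2) k) ab.1 ab.2) =
        (Pi.basisFun k n).toMatrix (stringBasis ht.isSl2Triple hdiag) := by
      simp only [C₁]; rw [Matrix.map_map]; ext i j; simp
    have h2 : C₂.map (MvPolynomial.eval fun ab : Fin 2 × Fin 2 =>
        (g : Matrix (Fin 2) (Fin 2) k) ab.1 ab.2) =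
        (stringBasis ht.isSl2Triple hdiag).toMatrix (Pi.basisFun k n) := by
      simp only [C₂]; rw [Matrix.map_map]; ext i j; simp
    rw [coe_expRep_eq_conj, RingHom.map_matrix_mul, Matrix.map_mul, eval_repMatPoly, h1, h2]
  · simp only [MonoidHom.codRestrict_apply, glCoordFun_inr, Sum.elim_inr, MvPolynomial.eval_C,
      det_coe_expRep, inv_one]

end IsIntegrableTriple

end Literature.RepresentationTheory.AlgebraicGroups.Sl2Exp
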